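import Summits.BirchSwinnertonDyer.Rank1Residual.X12.CubicModelKodaira
import Summits.BirchSwinnertonDyer.Rank1Residual.X12.CMTamagawaThreeAll
import HarnessLib

/-!
# The Kodaira type of a CM curve at an odd bad prime `p ≥ 5`, `p ∤ d_K`: `I₀*` unless
# `j ∈ {0, 1728}`; `III, I₀*, III*` for `j = 1728`; `II, IV, I₀*, IV*, II*` for `j = 0`
# (CLASS-CLOSURE §3.14, E2 sub-partition of the X12 inert-bad core by semistability defect)

HONEST FRAMING (cell `b2b-bsdres`, run/shared/lean/b2b/bsd-rank1-residual/, verbatim in every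
file): the goal of the cell is to DELETE the COMBINATION-SHAPED residual classes of the
Birch–Swinnerton-Dyer formula for ALL analytic-rank `≤ 1` elliptic curves over `ℚ` — "full BSD
formula for every rank `≤ 1` curve in class `C`" assembled STRICTLY from published theorems — so
that the rank-`≤ 1` remainder becomes exactly the CONSTRUCTION-SHAPED classes, which are TYPED
(missing-input `Prop`s), NOT attempted. This is not "finishing BSD". Unit `b2b-bsdres-x1b` (X12
prover owner), generation 23; research route, no claim beyond the stated class; X12 REMAINS
CONSTRUCTION-SHAPED; nothing is booked here — booking is the lane's and the referee's.

Theorems only; no definition, no new named fact. Kernel form of the E2 SUB-PARTITION of the X12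
corner "CM, `r_an = 1`, `p ≥ 5` BAD, `p` not split" (HOME `CLASS-CLOSURE-PLAN.md` §3.14, memo
`b2b-bsdres-x1b/gen23/O10-TARGET.md`): at a place `v` of residue characteristic `ℓ ≥ 5` NOT ramified
in the CM field, a CM curve over `ℚ` has good reduction or additive potentially good reduction whose
Kodaira type (equivalently its semistability defect `e ∈ {2, 3, 4, 6}` = the order of the tame
character `χ_v` with `T E|_{G_{ℚ_v}} = T A ⊗ χ_v`, `A` a twist good at `v`) is dictated by `j`:
`j ∉ {0, 1728}`: a quadratic twist `E₀^{(n)}` of an integral model good at `v` (*AEC* X.5.4), so GOOD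
or `I₀*` (§1, gen 22's `kodairaSymbolAt_twist_of_valuation_eq`); `j = 1728`: GOOD, `III`, `I₀*`, `III*`
(§2, every `v ∤ 2`, gen 22's `kodairaSymbolAt_of_quartic_model`); `j = 0`: GOOD, `II, IV, I₀*, IV*, II*`
(`CubicModelKodaira.lean`, every `v ∤ 6`). §3: `hasGoodReductionAt_or_kodairaSymbolAt_of_hasCM` and
the class-X12 corollary. Census companion (evidence, not a theorem): HOME
`b2b-bsdres-x1b/gen23/e2/O10-O11-SUBPARTITION.tsv` (995 inert pairs `N < 5·10⁵`: `I₀*` 274,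
`IV/IV*` 294, `III/III*` 130, `II/II*` 297). Not claimed: places over `2`, `3`, over primes ramified
in the CM field; anything about BSD.

References: [SilvermanATAEC1994] IV.9.4, Table 4.1, App. A §3; [SilvermanAEC2009] VII.1 Rem. 1.1,
X.5 Prop. 5.4; [Cremona1997] Table 1; HOME `CLASS-CLOSURE-PLAN.md` §3.14, `X12-ROUTE.md` §27.
-/

noncomputable section

open scoped Classical NumberField

open WeierstrassCurve NumberField IsDedekindDomain IsDedekindDomain.HeightOneSpectrum Field
  Rat.HeightOneSpectrum Literature.NumberTheory.EllipticCurves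
  Literature.NumberTheory.GaloisRepresentations
  Literature.NumberTheory.EllipticCurves.ModularForms
  Literature.NumberTheory.EllipticCurves.Rank1Residual
  Literature.NumberTheory.EllipticCurves.Rank1Residual.Typed
  Literature.NumberTheory.Automorphic
  Literature.NumberTheory.DiophantineGeometry
  Literature.NumberTheory.DiophantineGeometry.TateAlgorithm
  Summit.BirchSwinnertonDyer.Rank1Residual.X11b

namespace Summit.BirchSwinnertonDyer.Rank1Residual.X12

/-- `2` and the residue characteristic: `ℓ ≠ 2 ⟹ v(2) = 1`. [folklore] -/
private theorem valuation_two_eq_one_of_ne (v : HeightOneSpectrum (𝓞 ℚ)) (hv2 : natGenerator v ≠ 2) :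
    v.valuation ℚ (2 : ℚ) = 1 := by
  have hp2 : ¬ (natGenerator v : ℤ) ∣ 2 := fun h ↦ hv2 <| by
    have h' : natGenerator v ∣ 2 := by exact_mod_cast h
    exact (Nat.prime_dvd_prime_iff_eq (prime_natGenerator v) Nat.prime_two).mp h'
  have := Rat.valuation_intCast_eq_one v hp2; exact_mod_cast this

/-- A prime `ℓ ∉ {2, 3, q}` does not divide `± 2^a 3^b q^c`. [folklore] -/
private theorem not_dvd_of_natAbs_eq {ℓ q : ℕ} (hℓ : ℓ.Prime) (hq : q.Prime) (h2 : ℓ ≠ 2) (h3 : ℓ ≠ 3)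
    (hq' : ℓ ≠ q) {z : ℤ} {a b c : ℕ} (hz : z.natAbs = 2 ^ a * 3 ^ b * q ^ c) : ¬ (ℓ : ℤ) ∣ z := by
  intro h
  have hn : ℓ ∣ z.natAbs := Int.natCast_dvd.mp h
  rw [hz] at hn
  rcases (Nat.Prime.dvd_mul hℓ).mp hn with h | h
  · rcases (Nat.Prime.dvd_mul hℓ).mp h with h | h
    · exact h2 ((Nat.prime_dvd_prime_iff_eq hℓ Nat.prime_two).mp (hℓ.dvd_of_dvd_pow h))
    · exact h3 ((Nat.prime_dvd_prime_iff_eq hℓ Nat.prime_three).mp (hℓ.dvd_of_dvd_pow h))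
  · exact hq' ((Nat.prime_dvd_prime_iff_eq hℓ hq).mp (hℓ.dvd_of_dvd_pow h))

/-! ### §1 Quadratic twists of an integral model good at `v ∤ 2`: good or `I₀*` -/

/-- **Every curve with the `j`-invariant (`≠ 0, 1728`) of an integral model `E₀ = [a₁,…,a₆]` with
`ℓ ∤ Δ(E₀)` has, at the place `v ∤ 2` over `ℓ`, good reduction or Kodaira type `I₀*`.** Such a curve
is `E₀^{(d)}` (*AEC* X.5.4, `exists_variableChange_eq_quadraticTwist_of_j_eq'`); writing `d = c²n`
with `n` a square-free integer (`Rat.exists_sq_mul_squarefree`, `quadraticTwist_sq_mul`), the twist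
`E₀^{(n)}` is good at `v` (`ℓ ∤ n`: unit discriminant) or of type `I₀*` (`ℓ ∥ n`: gen 22's
`kodairaSymbolAt_twist_of_valuation_eq`, Tate's algorithm Step 6).
[cite: SilvermanATAEC1994, IV.9.4 Step 6 and Table 4.1] [cite: SilvermanAEC2009, X.5 Prop. 5.4 and VII.1 Remark 1.1] -/
theorem hasGoodReductionAt_or_kodairaSymbolAt_eq_Istar_zero_of_j_eq_twist (W : WeierstrassCurve ℚ)
    [W.IsElliptic] (v : HeightOneSpectrum (𝓞 ℚ)) (hv2 : natGenerator v ≠ 2) (a1 a2 a3 a4 a6 : ℤ)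
    [hE : (⟨(a1 : ℚ), (a2 : ℚ), (a3 : ℚ), (a4 : ℚ), (a6 : ℚ)⟩ : WeierstrassCurve ℚ).IsElliptic]
    {Dz : ℤ} (hΔ : (⟨(a1 : ℚ), (a2 : ℚ), (a3 : ℚ), (a4 : ℚ), (a6 : ℚ)⟩ : WeierstrassCurve ℚ).Δ = Dz)
    (hDℓ : ¬ (natGenerator v : ℤ) ∣ Dz)
    (hj : W.j = (⟨(a1 : ℚ), (a2 : ℚ), (a3 : ℚ), (a4 : ℚ), (a6 : ℚ)⟩ : WeierstrassCurve ℚ).j)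
    (h0 : W.j ≠ 0) (h1728 : W.j ≠ 1728) :
    W.HasGoodReductionAt v ∨ W.kodairaSymbolAt v = .Istar 0 := by
  set E₀ : WeierstrassCurve ℚ := ⟨(a1 : ℚ), (a2 : ℚ), (a3 : ℚ), (a4 : ℚ), (a6 : ℚ)⟩ with hE₀
  -- integrality of `E₀` at `v` and `v(Δ(E₀)) = 1`
  have hb₂ : v.valuation ℚ E₀.b₂ ≤ 1 := by
    rw [show E₀.b₂ = ((a1 * a1 + 4 * a2 : ℤ) : ℚ) by rw [hE₀]; simp only [WeierstrassCurve.b₂]; push_cast; ring]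
    exact valuation_ringOfIntegers_intCast_le_one v _
  have hb₄ : v.valuation ℚ E₀.b₄ ≤ 1 := by
    rw [show E₀.b₄ = ((2 * a4 + a1 * a3 : ℤ) : ℚ) by rw [hE₀]; simp only [WeierstrassCurve.b₄]; push_cast; ring]
    exact valuation_ringOfIntegers_intCast_le_one v _
  have hb₆ : v.valuation ℚ E₀.b₆ ≤ 1 := by
    rw [show E₀.b₆ = ((a3 * a3 + 4 * a6 : ℤ) : ℚ) by rw [hE₀]; simp only [WeierstrassCurve.b₆]; push_cast; ring]
    exact valuation_ringOfIntegers_intCast_le_one v _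
  have hΔ₀ : v.valuation ℚ E₀.Δ = 1 := by
    rw [hΔ]; exact Rat.valuation_intCast_eq_one v hDℓ
  -- the twist normal form with square-free parameter
  obtain ⟨d, hd0, C, hC⟩ := exists_variableChange_eq_quadraticTwist_of_j_eq' (E := E₀) hj h0 h1728
  obtain ⟨c, n, hc, hsq, hdn⟩ := Rat.exists_sq_mul_squarefree hd0
  have hn0 : n ≠ 0 := by rintro rfl; simp at hdn; exact hd0 hdn
  set T : VariableChange ℚ := ⟨(Units.mk0 c hc)⁻¹, 0, 0, 0⟩ with hT
  have hM : E₀.quadraticTwist (n : ℚ) = (T⁻¹ * C) • W := by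
    rw [mul_smul, hC, hdn, quadraticTwist_sq_mul E₀ hc, ← hT, inv_smul_smul]
  by_cases hℓn : (natGenerator v : ℤ) ∣ n
  · -- `ℓ ∥ n`: type `I₀*`
    right
    have hℓ2n : ¬ (natGenerator v : ℤ) ^ 2 ∣ n := fun h9 ↦ by
      have hu := hsq (natGenerator v : ℤ) (by simpa [sq] using h9)
      rw [Int.isUnit_iff] at hu
      have := (prime_natGenerator v).two_le
      omega
    have hnv : v.valuation ℚ (n : ℚ) = WithZero.exp (-1 : ℤ) :=
      valuation_ringOfIntegers_intCast_eq_exp_neg_one v hℓn hℓ2n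
    exact kodairaSymbolAt_twist_of_valuation_eq W v hv2 E₀ hb₂ hb₄ hb₆ hΔ₀ hnv _ hM
  · -- `ℓ ∤ n`: good reduction at `v`
    left
    have hnv : v.valuation ℚ (n : ℚ) = 1 := Rat.valuation_intCast_eq_one v hℓn
    have h2 : v.valuation ℚ (2 : ℚ) = 1 := valuation_two_eq_one_of_ne v hv2
    have h4 : v.valuation ℚ (4 : ℚ) = 1 := by
      rw [show (4 : ℚ) = 2 ^ 2 by norm_num, map_pow, h2, one_pow]
    set M := E₀.quadraticTwist (n : ℚ) with hMdef
    haveI : M.IsElliptic := by rw [hM]; infer_instance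
    have hint : M.IsIntegralAt v := by
      refine M.isIntegralAt_of_valuation_le_one v (by simp [hMdef, quadraticTwist_a₁]) ?_
        (by simp [hMdef, quadraticTwist_a₃]) ?_ ?_
      · rw [hMdef, quadraticTwist_a₂, map_div₀, map_mul, hnv, h4, one_mul, div_one]; exact hb₂
      · rw [hMdef, quadraticTwist_a₄, map_div₀, map_mul, map_pow, hnv, h2, one_pow, one_mul, div_one]
        exact hb₄
      · rw [hMdef, quadraticTwist_a₆, map_div₀, map_mul, map_pow, hnv, h4, one_pow, one_mul, div_one]
        exact hb₆
    have hΔ1 : v.valuation ℚ M.Δ = 1 := by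
      rw [hMdef, quadraticTwist_Δ, map_mul, map_pow, hnv, one_pow, one_mul, hΔ₀]
    have hmin : M.IsMinimalAt v := isMinimalAt_of_lt_valuation_Δ_holds hint
      (by rw [hΔ1, ← WithZero.exp_zero]; exact WithZero.exp_lt_exp.mpr (by norm_num))
    have hgoodM : M.HasGoodReductionAt v :=
      (hasGoodReductionAt_iff_of_isMinimalAt (v := v) (W := M) hmin).mpr hΔ1
    rw [hM] at hgoodM; exact (hasGoodReductionAt_smul_iff_holds v W _).mp hgoodM

/-! ### §2 `j = 1728` at every place `v ∤ 2`: good, `III`, `I₀*` or `III*` -/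

/-- **Every elliptic curve over `ℚ` with `j = 1728` has, at every place `v ∤ 2`, good reduction or
Kodaira type `III`, `I₀*`, `III*`** (semistability defect `4, 2, 4`): `W ≅ y² = x³ + 2^r A₀ x`
(`exists_variableChange_eq_of_j_eq_1728`); rescale `A₀ = ℓⁿ A₁`, `ℓ ∤ A₁`, by `ℓ^{4k}` to
`ord_v a = s ∈ {0, 1, 2, 3}`: `s = 0` is good reduction, `s ≥ 1` is gen 22's engine
`kodairaSymbolAt_of_quartic_model`. [cite: SilvermanATAEC1994, IV.9.4 and Table 4.1]
[cite: SilvermanAEC2009, X.5 Prop. 5.4 (iii) and VII.1 Remark 1.1] -/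
theorem hasGoodReductionAt_or_kodairaSymbolAt_of_j_eq_1728 (W : WeierstrassCurve ℚ) [W.IsElliptic]
    (hj : W.j = 1728) (v : HeightOneSpectrum (𝓞 ℚ)) (hv2 : natGenerator v ≠ 2) :
    W.HasGoodReductionAt v ∨ W.kodairaSymbolAt v = .III ∨ W.kodairaSymbolAt v = .Istar 0 ∨
      W.kodairaSymbolAt v = .IIIstar := by
  have hℓ : v.valuation ℚ (natGenerator v : ℚ) = WithZero.exp (-1 : ℤ) := Rat.valuation_natGenerator v
  have hℓ0 : (natGenerator v : ℚ) ≠ 0 := by exact_mod_cast (prime_natGenerator v).ne_zero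
  have h2 : v.valuation ℚ (2 : ℚ) = 1 := valuation_two_eq_one_of_ne v hv2
  -- the quartic model and its `v`-adic normalisation
  obtain ⟨r, A₀, C, -, hA₀, hC⟩ := exists_variableChange_eq_of_j_eq_1728 W hj
  have hA₀0 : A₀ ≠ 0 := fun h ↦ by simp [h] at hA₀
  obtain ⟨A₁, hA₁, hℓA₁⟩ := (Int.finiteMultiplicity_iff.mpr
    ⟨by rw [Int.natAbs_natCast]; exact (prime_natGenerator v).one_lt.ne', hA₀0⟩ :
    FiniteMultiplicity (natGenerator v : ℤ) A₀).exists_eq_pow_mul_and_not_dvd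
  set n := multiplicity (natGenerator v : ℤ) A₀ with hn
  obtain ⟨k, s, hs4, hns⟩ : ∃ k s : ℕ, s < 4 ∧ n = 4 * k + s := ⟨n / 4, n % 4, Nat.mod_lt _ (by norm_num),
    (Nat.div_add_mod n 4).symm⟩
  set u : ℚˣ := Units.mk0 ((natGenerator v : ℚ) ^ k) (pow_ne_zero _ hℓ0) with hu
  set a : ℚ := (2 : ℚ) ^ r * ((natGenerator v : ℚ) ^ s * A₁) with ha_def
  have hscale : (⟨u, 0, 0, 0⟩ : VariableChange ℚ) • (C • W) = ⟨0, 0, 0, a, 0⟩ := by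
    rw [hC, smul_quartic_scale]
    congr 1
    have hu4 : ((u⁻¹ : ℚˣ) : ℚ) ^ 4 = (((natGenerator v : ℚ)) ^ (4 * k))⁻¹ := by
      rw [Units.val_inv_eq_inv_val, hu, Units.val_mk0, inv_pow, ← pow_mul, mul_comm]
    rw [hu4, hA₁, hns, ha_def]; push_cast
    have hℓk : ((natGenerator v : ℚ) ^ (4 * k)) ≠ 0 := pow_ne_zero _ hℓ0
    field_simp; ring
  have hva : v.valuation ℚ a = WithZero.exp (-(s : ℤ)) := by
    have hA₁v : v.valuation ℚ (A₁ : ℚ) = 1 := Rat.valuation_intCast_eq_one v hℓA₁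
    rw [ha_def, map_mul, map_pow, h2, one_pow, one_mul, map_mul, map_pow, hℓ, hA₁v, mul_one,
      ← WithZero.exp_nsmul]
    simp
  have hM : (⟨0, 0, 0, a, 0⟩ : WeierstrassCurve ℚ) = ((⟨u, 0, 0, 0⟩ : VariableChange ℚ) * C) • W := by
    rw [mul_smul, hscale]
  rcases Nat.eq_zero_or_pos s with hs0 | hs1
  · -- `s = 0`: good reduction at `v`
    subst hs0
    left
    set M : WeierstrassCurve ℚ := ⟨0, 0, 0, a, 0⟩ with hMdef
    haveI : M.IsElliptic := by rw [hM]; infer_instance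
    have hva1 : v.valuation ℚ a = 1 := by rw [hva]; simp
    have hint : M.IsIntegralAt v :=
      M.isIntegralAt_of_valuation_le_one v (by simp [hMdef]) (by simp [hMdef]) (by simp [hMdef])
        (by rw [show M.a₄ = a from rfl, hva1]) (by simp [hMdef])
    have hΔ1 : v.valuation ℚ M.Δ = 1 := by
      rw [show M.Δ = -(2 : ℚ) ^ 6 * a ^ 3 by
        simp only [hMdef, WeierstrassCurve.Δ, WeierstrassCurve.b₂, WeierstrassCurve.b₄,
          WeierstrassCurve.b₆, WeierstrassCurve.b₈]; ring,
        map_mul, Valuation.map_neg, map_pow, h2, one_pow, one_mul, map_pow, hva1, one_pow]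
    have hmin : M.IsMinimalAt v :=
      isMinimalAt_of_lt_valuation_Δ_holds hint (by rw [hΔ1, ← WithZero.exp_zero]; exact WithZero.exp_lt_exp.mpr (by norm_num))
    have hgoodM : M.HasGoodReductionAt v := (hasGoodReductionAt_iff_of_isMinimalAt (v := v) (W := M) hmin).mpr hΔ1
    rw [hM] at hgoodM
    exact (hasGoodReductionAt_smul_iff_holds v W _).mp hgoodM
  · -- `s ∈ {1, 2, 3}`: types `III`, `I₀*`, `III*`
    right
    exact kodairaSymbolAt_of_quartic_model W v hv2 _ ((⟨u, 0, 0, 0⟩ : VariableChange ℚ) * C) hM rfl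
      hs1 (by omega) hva

/-! ### §3 Every CM curve at a place of residue characteristic `ℓ ≥ 5` unramified in the CM field -/

/-- **The Kodaira type of a CM curve over `ℚ` at a place `v` of residue characteristic `ℓ ≥ 5`
NOT ramified in the CM field is dictated by `j`**: good reduction, or — `j = 0`: `II, IV, I₀*, IV*,
II*`; `j = 1728`: `III, I₀*, III*`; the eleven other CM `j`: `I₀*` (each a quadratic twist of the
base curve Cremona `36a2, 27a4, 32a3, 49a1, 49a2, 256a1, 121b1, 361a1, 1849a1, 4489a1, 26569a1`, good
away from `2, 3, |d_K|`). `HasCM ⟺ j ∈ cmJInvariants` is the tree theorem `hasCM_iff_j_mem_holds`.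
[cite: SilvermanATAEC1994, IV.9.4, Table 4.1 and App. A §3] [cite: SilvermanAEC2009, X.5 Prop. 5.4]
[cite: Cremona1997, Table 1 (curves 27a4, 32a3, 36a2, 49a1, 49a2, 121b1, 256a1, 361a1, 1849a1, 4489a1, 26569a1)] -/
theorem hasGoodReductionAt_or_kodairaSymbolAt_of_hasCM (W : WeierstrassCurve ℚ) [W.IsElliptic]
    (hCM : W.HasCM) (v : HeightOneSpectrum (𝓞 ℚ)) (h5 : 5 ≤ natGenerator v)
    (hnr : ¬ CMRamified W (natGenerator v)) :
    W.HasGoodReductionAt v ∨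
      (W.j = 0 ∧ (W.kodairaSymbolAt v = .II ∨ W.kodairaSymbolAt v = .IV ∨
        W.kodairaSymbolAt v = .Istar 0 ∨ W.kodairaSymbolAt v = .IVstar ∨ W.kodairaSymbolAt v = .IIstar)) ∨
      (W.j = 1728 ∧ (W.kodairaSymbolAt v = .III ∨ W.kodairaSymbolAt v = .Istar 0 ∨
        W.kodairaSymbolAt v = .IIIstar)) ∨
      (W.j ≠ 0 ∧ W.j ≠ 1728 ∧ W.kodairaSymbolAt v = .Istar 0) := by
  have hℓ : (natGenerator v).Prime := prime_natGenerator v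
  have hv2 : natGenerator v ≠ 2 := by omega
  have hv3 : natGenerator v ≠ 3 := by omega
  have hj : W.j ∈ cmJInvariants := (hasCM_iff_j_mem_holds W).mp hCM
  -- `ℓ ≠ |d_K|` from `¬ CMRamified`
  have hne : ∀ {j₀ : ℚ} {q : ℕ}, W.j = j₀ → cmFieldDiscrOfJ j₀ = -(q : ℤ) → natGenerator v ≠ q :=
    fun {j₀} {q} h hd hq ↦ hnr (by unfold CMRamified; rw [h, hd, hq]; exact Dvd.dvd.neg_right dvd_rfl)
  -- the generic twist case
  have twist : ∀ (a1 a2 a3 a4 a6 : ℤ)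
      [hE : (⟨(a1 : ℚ), (a2 : ℚ), (a3 : ℚ), (a4 : ℚ), (a6 : ℚ)⟩ : WeierstrassCurve ℚ).IsElliptic] (Dz : ℤ),
      (⟨(a1 : ℚ), (a2 : ℚ), (a3 : ℚ), (a4 : ℚ), (a6 : ℚ)⟩ : WeierstrassCurve ℚ).Δ = Dz →
      ¬ (natGenerator v : ℤ) ∣ Dz →
      W.j = (⟨(a1 : ℚ), (a2 : ℚ), (a3 : ℚ), (a4 : ℚ), (a6 : ℚ)⟩ : WeierstrassCurve ℚ).j →
      W.j ≠ 0 → W.j ≠ 1728 → _ :=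
    fun a1 a2 a3 a4 a6 _ Dz hΔ hDℓ hjE h0 h1728 ↦
      hasGoodReductionAt_or_kodairaSymbolAt_eq_Istar_zero_of_j_eq_twist W v hv2 a1 a2 a3 a4 a6 hΔ hDℓ
        hjE h0 h1728
  have fin : ∀ {P : Prop}, W.j ≠ 0 → W.j ≠ 1728 → (W.HasGoodReductionAt v ∨ W.kodairaSymbolAt v = .Istar 0) →
      (W.HasGoodReductionAt v ∨ P ∨ (W.j = 1728 ∧ (W.kodairaSymbolAt v = .III ∨
        W.kodairaSymbolAt v = .Istar 0 ∨ W.kodairaSymbolAt v = .IIIstar)) ∨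
        (W.j ≠ 0 ∧ W.j ≠ 1728 ∧ W.kodairaSymbolAt v = .Istar 0)) := by
    intro P h0 h1728 h
    rcases h with h | h
    · exact Or.inl h
    · exact Or.inr (Or.inr (Or.inr ⟨h0, h1728, h⟩))
  simp only [cmJInvariants, Finset.mem_insert, Finset.mem_singleton] at hj
  rcases hj with h | h | h | h | h | h | h | h | h | h | h | h | h
  · -- `j = 0`
    rcases hasGoodReductionAt_or_kodairaSymbolAt_of_j_eq_zero W h v hv2 hv3 with hg | hk
    · exact Or.inl hg
    · exact Or.inr (Or.inl ⟨h, hk⟩)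
  · -- `j = 1728`
    rcases hasGoodReductionAt_or_kodairaSymbolAt_of_j_eq_1728 W h v hv2 with hg | hk
    · exact Or.inl hg
    · exact Or.inr (Or.inr (Or.inl ⟨h, hk⟩))
  · -- `j = -3375`: base `49a1 = [1, -1, 0, -2, -1]`, `Δ = -343 = -7³`
    haveI := isElliptic_of_discOf_ne_zero 1 (-1) 0 (-2) (-1) (by decide)
    have hjE : (⟨((1 : ℤ) : ℚ), ((-1 : ℤ) : ℚ), ((0 : ℤ) : ℚ), ((-2 : ℤ) : ℚ), ((-1 : ℤ) : ℚ)⟩ : WeierstrassCurve ℚ).j = -3375 := by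
      rw [j, Units.inv_mul_eq_iff_eq_mul, coe_Δ']
      norm_num [WeierstrassCurve.c₄, WeierstrassCurve.Δ, WeierstrassCurve.b₂, WeierstrassCurve.b₄, WeierstrassCurve.b₆, WeierstrassCurve.b₈]
    refine fin (by rw [h]; norm_num) (by rw [h]; norm_num) (twist 1 (-1) 0 (-2) (-1) (-343)
      (by norm_num [WeierstrassCurve.Δ, WeierstrassCurve.b₂, WeierstrassCurve.b₄, WeierstrassCurve.b₆, WeierstrassCurve.b₈])
      (not_dvd_of_natAbs_eq hℓ (by norm_num : (7).Prime) hv2 hv3 (hne h (by norm_num [cmFieldDiscrOfJ]))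
        (a := 0) (b := 0) (c := 3) (by norm_num)) (h.trans hjE.symm) (by rw [h]; norm_num) (by rw [h]; norm_num))
  · -- `j = 8000`: base `256a1 = [0, 1, 0, -3, 1]`, `Δ = 512 = 2⁹`
    haveI := isElliptic_of_discOf_ne_zero 0 1 0 (-3) 1 (by decide)
    have hjE : (⟨((0 : ℤ) : ℚ), ((1 : ℤ) : ℚ), ((0 : ℤ) : ℚ), ((-3 : ℤ) : ℚ), ((1 : ℤ) : ℚ)⟩ : WeierstrassCurve ℚ).j = 8000 := by
      rw [j, Units.inv_mul_eq_iff_eq_mul, coe_Δ']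
      norm_num [WeierstrassCurve.c₄, WeierstrassCurve.Δ, WeierstrassCurve.b₂, WeierstrassCurve.b₄, WeierstrassCurve.b₆, WeierstrassCurve.b₈]
    refine fin (by rw [h]; norm_num) (by rw [h]; norm_num) (twist 0 1 0 (-3) 1 512
      (by norm_num [WeierstrassCurve.Δ, WeierstrassCurve.b₂, WeierstrassCurve.b₄, WeierstrassCurve.b₆, WeierstrassCurve.b₈])
      (not_dvd_of_natAbs_eq hℓ Nat.prime_two hv2 hv3 hv2 (a := 9) (b := 0) (c := 0) (by norm_num)) (h.trans hjE.symm) (by rw [h]; norm_num) (by rw [h]; norm_num))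
  · -- `j = -32768`: base `121b1 = [0, -1, 1, -7, 10]`, `Δ = -1331 = -11³`
    haveI := isElliptic_of_discOf_ne_zero 0 (-1) 1 (-7) 10 (by decide)
    have hjE : (⟨((0 : ℤ) : ℚ), ((-1 : ℤ) : ℚ), ((1 : ℤ) : ℚ), ((-7 : ℤ) : ℚ), ((10 : ℤ) : ℚ)⟩ : WeierstrassCurve ℚ).j = -32768 := by
      rw [j, Units.inv_mul_eq_iff_eq_mul, coe_Δ']
      norm_num [WeierstrassCurve.c₄, WeierstrassCurve.Δ, WeierstrassCurve.b₂, WeierstrassCurve.b₄, WeierstrassCurve.b₆, WeierstrassCurve.b₈]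
    refine fin (by rw [h]; norm_num) (by rw [h]; norm_num) (twist 0 (-1) 1 (-7) 10 (-1331)
      (by norm_num [WeierstrassCurve.Δ, WeierstrassCurve.b₂, WeierstrassCurve.b₄, WeierstrassCurve.b₆, WeierstrassCurve.b₈])
      (not_dvd_of_natAbs_eq hℓ (by norm_num : (11).Prime) hv2 hv3 (hne h (by norm_num [cmFieldDiscrOfJ]))
        (a := 0) (b := 0) (c := 3) (by norm_num)) (h.trans hjE.symm) (by rw [h]; norm_num) (by rw [h]; norm_num))
  · -- `j = 54000`: base `36a2 = [0, 0, 0, -15, 22]`, `Δ = 6912 = 2⁸·3³`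
    haveI := isElliptic_of_discOf_ne_zero 0 0 0 (-15) 22 (by decide)
    have hjE : (⟨((0 : ℤ) : ℚ), ((0 : ℤ) : ℚ), ((0 : ℤ) : ℚ), ((-15 : ℤ) : ℚ), ((22 : ℤ) : ℚ)⟩ : WeierstrassCurve ℚ).j = 54000 := by
      rw [j, Units.inv_mul_eq_iff_eq_mul, coe_Δ']
      norm_num [WeierstrassCurve.c₄, WeierstrassCurve.Δ, WeierstrassCurve.b₂, WeierstrassCurve.b₄, WeierstrassCurve.b₆, WeierstrassCurve.b₈]
    refine fin (by rw [h]; norm_num) (by rw [h]; norm_num) (twist 0 0 0 (-15) 22 6912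
      (by norm_num [WeierstrassCurve.Δ, WeierstrassCurve.b₂, WeierstrassCurve.b₄, WeierstrassCurve.b₆, WeierstrassCurve.b₈])
      (not_dvd_of_natAbs_eq hℓ Nat.prime_two hv2 hv3 hv2 (a := 8) (b := 3) (c := 0) (by norm_num)) (h.trans hjE.symm) (by rw [h]; norm_num) (by rw [h]; norm_num))
  · -- `j = 287496`: base `32a3 = [0, 0, 0, -11, -14]`, `Δ = 512 = 2⁹`
    haveI := isElliptic_of_discOf_ne_zero 0 0 0 (-11) (-14) (by decide)
    have hjE : (⟨((0 : ℤ) : ℚ), ((0 : ℤ) : ℚ), ((0 : ℤ) : ℚ), ((-11 : ℤ) : ℚ), ((-14 : ℤ) : ℚ)⟩ : WeierstrassCurve ℚ).j = 287496 := by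
      rw [j, Units.inv_mul_eq_iff_eq_mul, coe_Δ']
      norm_num [WeierstrassCurve.c₄, WeierstrassCurve.Δ, WeierstrassCurve.b₂, WeierstrassCurve.b₄, WeierstrassCurve.b₆, WeierstrassCurve.b₈]
    refine fin (by rw [h]; norm_num) (by rw [h]; norm_num) (twist 0 0 0 (-11) (-14) 512
      (by norm_num [WeierstrassCurve.Δ, WeierstrassCurve.b₂, WeierstrassCurve.b₄, WeierstrassCurve.b₆, WeierstrassCurve.b₈])
      (not_dvd_of_natAbs_eq hℓ Nat.prime_two hv2 hv3 hv2 (a := 9) (b := 0) (c := 0) (by norm_num)) (h.trans hjE.symm) (by rw [h]; norm_num) (by rw [h]; norm_num))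
  · -- `j = -884736`: base `361a1 = [0, 0, 1, -38, 90]`, `Δ = -6859 = -19³`
    haveI := isElliptic_of_discOf_ne_zero 0 0 1 (-38) 90 (by decide)
    have hjE : (⟨((0 : ℤ) : ℚ), ((0 : ℤ) : ℚ), ((1 : ℤ) : ℚ), ((-38 : ℤ) : ℚ), ((90 : ℤ) : ℚ)⟩ : WeierstrassCurve ℚ).j = -884736 := by
      rw [j, Units.inv_mul_eq_iff_eq_mul, coe_Δ']
      norm_num [WeierstrassCurve.c₄, WeierstrassCurve.Δ, WeierstrassCurve.b₂, WeierstrassCurve.b₄, WeierstrassCurve.b₆, WeierstrassCurve.b₈]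
    refine fin (by rw [h]; norm_num) (by rw [h]; norm_num) (twist 0 0 1 (-38) 90 (-6859)
      (by norm_num [WeierstrassCurve.Δ, WeierstrassCurve.b₂, WeierstrassCurve.b₄, WeierstrassCurve.b₆, WeierstrassCurve.b₈])
      (not_dvd_of_natAbs_eq hℓ (by norm_num : (19).Prime) hv2 hv3 (hne h (by norm_num [cmFieldDiscrOfJ]))
        (a := 0) (b := 0) (c := 3) (by norm_num)) (h.trans hjE.symm) (by rw [h]; norm_num) (by rw [h]; norm_num))
  · -- `j = -12288000`: base `27a4 = [0, 0, 1, -30, 63]`, `Δ = -243 = -3⁵`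
    haveI := isElliptic_of_discOf_ne_zero 0 0 1 (-30) 63 (by decide)
    have hjE : (⟨((0 : ℤ) : ℚ), ((0 : ℤ) : ℚ), ((1 : ℤ) : ℚ), ((-30 : ℤ) : ℚ), ((63 : ℤ) : ℚ)⟩ : WeierstrassCurve ℚ).j = -12288000 := by
      rw [j, Units.inv_mul_eq_iff_eq_mul, coe_Δ']
      norm_num [WeierstrassCurve.c₄, WeierstrassCurve.Δ, WeierstrassCurve.b₂, WeierstrassCurve.b₄, WeierstrassCurve.b₆, WeierstrassCurve.b₈]
    refine fin (by rw [h]; norm_num) (by rw [h]; norm_num) (twist 0 0 1 (-30) 63 (-243)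
      (by norm_num [WeierstrassCurve.Δ, WeierstrassCurve.b₂, WeierstrassCurve.b₄, WeierstrassCurve.b₆, WeierstrassCurve.b₈])
      (not_dvd_of_natAbs_eq hℓ Nat.prime_two hv2 hv3 hv2 (a := 0) (b := 5) (c := 0) (by norm_num)) (h.trans hjE.symm) (by rw [h]; norm_num) (by rw [h]; norm_num))
  · -- `j = 16581375`: base `49a2 = [1, -1, 0, -37, -78]`, `Δ = 343 = 7³`
    haveI := isElliptic_of_discOf_ne_zero 1 (-1) 0 (-37) (-78) (by decide)
    have hjE : (⟨((1 : ℤ) : ℚ), ((-1 : ℤ) : ℚ), ((0 : ℤ) : ℚ), ((-37 : ℤ) : ℚ), ((-78 : ℤ) : ℚ)⟩ : WeierstrassCurve ℚ).j = 16581375 := by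
      rw [j, Units.inv_mul_eq_iff_eq_mul, coe_Δ']
      norm_num [WeierstrassCurve.c₄, WeierstrassCurve.Δ, WeierstrassCurve.b₂, WeierstrassCurve.b₄, WeierstrassCurve.b₆, WeierstrassCurve.b₈]
    refine fin (by rw [h]; norm_num) (by rw [h]; norm_num) (twist 1 (-1) 0 (-37) (-78) 343
      (by norm_num [WeierstrassCurve.Δ, WeierstrassCurve.b₂, WeierstrassCurve.b₄, WeierstrassCurve.b₆, WeierstrassCurve.b₈])
      (not_dvd_of_natAbs_eq hℓ (by norm_num : (7).Prime) hv2 hv3 (hne h (by norm_num [cmFieldDiscrOfJ]))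
        (a := 0) (b := 0) (c := 3) (by norm_num)) (h.trans hjE.symm) (by rw [h]; norm_num) (by rw [h]; norm_num))
  · -- `j = -884736000`: base `1849a1 = [0, 0, 1, -860, 9707]`, `Δ = -79507 = -43³`
    haveI := isElliptic_of_discOf_ne_zero 0 0 1 (-860) 9707 (by decide)
    have hjE : (⟨((0 : ℤ) : ℚ), ((0 : ℤ) : ℚ), ((1 : ℤ) : ℚ), ((-860 : ℤ) : ℚ), ((9707 : ℤ) : ℚ)⟩ : WeierstrassCurve ℚ).j = -884736000 := by
      rw [j, Units.inv_mul_eq_iff_eq_mul, coe_Δ']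
      norm_num [WeierstrassCurve.c₄, WeierstrassCurve.Δ, WeierstrassCurve.b₂, WeierstrassCurve.b₄, WeierstrassCurve.b₆, WeierstrassCurve.b₈]
    refine fin (by rw [h]; norm_num) (by rw [h]; norm_num) (twist 0 0 1 (-860) 9707 (-79507)
      (by norm_num [WeierstrassCurve.Δ, WeierstrassCurve.b₂, WeierstrassCurve.b₄, WeierstrassCurve.b₆, WeierstrassCurve.b₈])
      (not_dvd_of_natAbs_eq hℓ (by norm_num : (43).Prime) hv2 hv3 (hne h (by norm_num [cmFieldDiscrOfJ]))
        (a := 0) (b := 0) (c := 3) (by norm_num)) (h.trans hjE.symm) (by rw [h]; norm_num) (by rw [h]; norm_num))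
  · -- `j = -147197952000`: base `4489a1 = [0, 0, 1, -7370, 243528]`, `Δ = -300763 = -67³`
    haveI := isElliptic_of_discOf_ne_zero 0 0 1 (-7370) 243528 (by decide)
    have hjE : (⟨((0 : ℤ) : ℚ), ((0 : ℤ) : ℚ), ((1 : ℤ) : ℚ), ((-7370 : ℤ) : ℚ), ((243528 : ℤ) : ℚ)⟩ : WeierstrassCurve ℚ).j = -147197952000 := by
      rw [j, Units.inv_mul_eq_iff_eq_mul, coe_Δ']
      norm_num [WeierstrassCurve.c₄, WeierstrassCurve.Δ, WeierstrassCurve.b₂, WeierstrassCurve.b₄, WeierstrassCurve.b₆, WeierstrassCurve.b₈]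
    refine fin (by rw [h]; norm_num) (by rw [h]; norm_num) (twist 0 0 1 (-7370) 243528 (-300763)
      (by norm_num [WeierstrassCurve.Δ, WeierstrassCurve.b₂, WeierstrassCurve.b₄, WeierstrassCurve.b₆, WeierstrassCurve.b₈])
      (not_dvd_of_natAbs_eq hℓ (by norm_num : (67).Prime) hv2 hv3 (hne h (by norm_num [cmFieldDiscrOfJ]))
        (a := 0) (b := 0) (c := 3) (by norm_num)) (h.trans hjE.symm) (by rw [h]; norm_num) (by rw [h]; norm_num))
  · -- `j = -262537412640768000`: base `26569a1 = [0, 0, 1, -2174420, 1234136692]`, `Δ = -4330747 = -163³`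
    haveI := isElliptic_of_discOf_ne_zero 0 0 1 (-2174420) 1234136692 (by decide)
    have hjE : (⟨((0 : ℤ) : ℚ), ((0 : ℤ) : ℚ), ((1 : ℤ) : ℚ), ((-2174420 : ℤ) : ℚ), ((1234136692 : ℤ) : ℚ)⟩ : WeierstrassCurve ℚ).j = -262537412640768000 := by
      rw [j, Units.inv_mul_eq_iff_eq_mul, coe_Δ']
      norm_num [WeierstrassCurve.c₄, WeierstrassCurve.Δ, WeierstrassCurve.b₂, WeierstrassCurve.b₄, WeierstrassCurve.b₆, WeierstrassCurve.b₈]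
    refine fin (by rw [h]; norm_num) (by rw [h]; norm_num) (twist 0 0 1 (-2174420) 1234136692 (-4330747)
      (by norm_num [WeierstrassCurve.Δ, WeierstrassCurve.b₂, WeierstrassCurve.b₄, WeierstrassCurve.b₆, WeierstrassCurve.b₈])
      (not_dvd_of_natAbs_eq hℓ (by norm_num : (163).Prime) hv2 hv3 (hne h (by norm_num [cmFieldDiscrOfJ]))
        (a := 0) (b := 0) (c := 3) (by norm_num)) (h.trans hjE.symm) (by rw [h]; norm_num) (by rw [h]; norm_num))

/-- **Semistability defect `2` off `j ∈ {0, 1728}`: a CM curve with `j ≠ 0, 1728` and BAD reduction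
at a place of residue characteristic `ℓ ≥ 5` unramified in the CM field has Kodaira type `I₀*`**
(it is the quadratic twist by a parameter of odd `ℓ`-valuation of a curve with good reduction at
`ℓ`). [cite: SilvermanATAEC1994, IV.9.4 Step 6 and Table 4.1] [cite: SilvermanAEC2009, X.5 Prop. 5.4] -/
theorem kodairaSymbolAt_eq_Istar_zero_of_hasCM_of_j_ne (W : WeierstrassCurve ℚ) [W.IsElliptic]
    (hCM : W.HasCM) (h0 : W.j ≠ 0) (h1728 : W.j ≠ 1728) (v : HeightOneSpectrum (𝓞 ℚ))
    (h5 : 5 ≤ natGenerator v) (hnr : ¬ CMRamified W (natGenerator v)) (hbad : ¬ W.HasGoodReductionAt v) :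
    W.kodairaSymbolAt v = .Istar 0 := by
  rcases hasGoodReductionAt_or_kodairaSymbolAt_of_hasCM W hCM v h5 hnr with h | ⟨hj, -⟩ | ⟨hj, -⟩ | ⟨-, -, h⟩
  · exact absurd h hbad
  · exact absurd hj h0
  · exact absurd hj h1728
  · exact h

/-- **Class X12 at an odd bad `p ≥ 5` not ramified in the CM field (the INERT-BAD CORE, and the
split-bad cells): the Kodaira type at `p` is `II, IV, I₀*, IV*, II*` (`j = 0`), `III, I₀*, III*`
(`j = 1728`), or `I₀*` (otherwise)** — the E2 sub-partition of HOME `CLASS-CLOSURE-PLAN.md` §3.14 by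
semistability defect `e ∈ {6,3,2,3,6} / {4,2,4} / {2}`. [cite: SilvermanATAEC1994, IV.9.4, Table 4.1 and App. A §3] -/
theorem kodairaSymbolAt_of_classX12_of_bad (W : WeierstrassCurve ℚ) [W.IsElliptic] (p : ℕ)
    [Fact p.Prime] (hX : ClassX12 W p) (hp5 : 5 ≤ p) (hnr : ¬ CMRamified W p)
    (v : HeightOneSpectrum (𝓞 ℚ)) (hv : natGenerator v = p) (hbad : ¬ W.HasGoodReductionAt v) :
    (W.j = 0 ∧ (W.kodairaSymbolAt v = .II ∨ W.kodairaSymbolAt v = .IV ∨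
        W.kodairaSymbolAt v = .Istar 0 ∨ W.kodairaSymbolAt v = .IVstar ∨ W.kodairaSymbolAt v = .IIstar)) ∨
      (W.j = 1728 ∧ (W.kodairaSymbolAt v = .III ∨ W.kodairaSymbolAt v = .Istar 0 ∨
        W.kodairaSymbolAt v = .IIIstar)) ∨
      (W.j ≠ 0 ∧ W.j ≠ 1728 ∧ W.kodairaSymbolAt v = .Istar 0) := by
  subst hv
  rcases hasGoodReductionAt_or_kodairaSymbolAt_of_hasCM W hX.1 v hp5 hnr with h | h
  · exact absurd h hbad
  · exact h

end Summit.BirchSwinnertonDyer.Rank1Residual.X12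

end
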